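import Mathlib
import HarnessLib
import HarnessLib.Audit
import Summits.Parity.Statement
import Literature.NumberTheory.Sieve.BombieriAsymptoticSieve
import Literature.NumberTheory.Sieve.BombieriAsymptoticSieveShiftedPrimes
import Literature.NumberTheory.Sieve.PretentiousDistance
import Literature.NumberTheory.Sieve.SingularSeries

/-!
Route: InverseSieve

CLOSED (retired) 2026-08-15T13:49:44Z by operator:999:1257524 — reason: not-a-thesis: assembly does not conclude the sub-problem Statement — note: D-0027 §2.1 audit (human 2026-08-15: routes that do not decide the summit are removed): the assembly concludes `(fun N : ℕ => ∑ n ∈ Finset.Icc 1 N, ArithmeticFunction.vonMangoldt n * ArithmeticFunction.vonMangoldt (n + h) - Literature.NumberTheory.Sieve.singularSeries ({0`, not the sub-problem state. The file is kept as the record of this route; refuted decls are indexed as negative knowledge (`ledger negatives`).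

# Route InverseSieve — Bombieri's sieve at k=1 under a multiplicative-orthogonality axiom; EH ∧
uniform Elliott on shifted primes ⟹ HL pairs

It suffices to show X = EH ∧ IST ∧ ESP (card inverse-sieve-theorem). IST (INVERSE SIEVE THEOREM, the
structure half): for a fixed
non-negative sequence with Bombieri's level-1 data (A₁)–(A₅), density constant H and A(x) ∼ x, the k
= 1 case of the asymptotic sieve
Σ_{n≤x} Λ(n) a_n ∼ H x — which Type-I data alone leave free up to δ ∈ [0,2] — holds as soon as a
satisfies AXIOM (M): for every ε there is
A₀ such that, for all large x, |Σ_{n≤x} a_n f(n)| ≤ ε x for EVERY 1-bounded multiplicative f with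
𝔻(f, χ n^{it}; x)² ≥ A₀ for all q ≤ A₀,
χ mod q, |t| ≤ x ("the only level-1 ghosts are pretentious-multiplicative"). ESP (the randomness
half): Axiom (M) for a_n = Λ(n+h), i.e.
the uniform Elliott conjecture on shifted primes. EH is the named conditional input (support item,
first antecedent of the Assembly);
the conclusion is Hardy–Littlewood pairs Σ_{n≤N} Λ(n)Λ(n+h) = 𝔖({0,h})N + o(N) for every FIXED h ≥ 1
(shift-uniformity is not claimed).
Lean: `Literature.NumberTheory.Sieve.LevelOfDistribution.ElliottHalberstam ∧ (∀ (A :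
Literature.NumberTheory.Sieve.SieveSequence) (H : ℝ), A.IsBombieriSequence → A.HasDensityConstant H
→ Asymptotics.IsEquivalent Filter.atTop A.size (fun x : ℝ => x) → (∀ ε : ℝ, 0 < ε → ∃ A₀ : ℝ, ∀ᶠ x :
ℝ in Filter.atTop, ∀ f : ArithmeticFunction ℂ, f.IsMultiplicative → (∀ n, ‖f n‖ ≤ 1) → (∀ (q : ℕ) (χ
: DirichletCharacter ℂ q) (t : ℝ), 1 ≤ q → (q : ℝ) ≤ A₀ → |t| ≤ x → A₀ ≤
Literature.NumberTheory.Sieve.pretentiousDistSq (⇑f) (Literature.NumberTheory.Sieve.twistedChar χ t)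
x) → ‖∑ n ∈ Finset.Ioc 0 ⌊x⌋₊, ((A.a n : ℝ) : ℂ) * f n‖ ≤ ε * x) → Asymptotics.IsEquivalent
Filter.atTop (fun x : ℝ => ∑ n ∈ Finset.Ioc 0 ⌊x⌋₊, ArithmeticFunction.vonMangoldt n * A.a n) (fun x
: ℝ => H * x)) ∧ (∀ h : ℕ, 1 ≤ h → ∀ ε : ℝ, 0 < ε → ∃ A₀ : ℝ, ∀ᶠ x : ℝ in Filter.atTop, ∀ f :
ArithmeticFunction ℂ, f.IsMultiplicative → (∀ n, ‖f n‖ ≤ 1) → (∀ (q : ℕ) (χ : DirichletCharacter ℂ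
q) (t : ℝ), 1 ≤ q → (q : ℝ) ≤ A₀ → |t| ≤ x → A₀ ≤ Literature.NumberTheory.Sieve.pretentiousDistSq
(⇑f) (Literature.NumberTheory.Sieve.twistedChar χ t) x) → ‖∑ n ∈ Finset.Ioc 0 ⌊x⌋₊,
((ArithmeticFunction.vonMangoldt (n + h) : ℝ) : ℂ) * f n‖ ≤ ε * x)`

## Assembly
Nearly pure logic given the items (sorry-free glue expected, size S/M): fix h ≥ 1. If h is odd, one
of n, n+h is even, so Σ_{n≤N}Λ(n)Λ(n+h) ≪ log² N and 𝔖({0,h}) = 0 (the factor at p = 2 vanishes: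
Literature singularSeriesFactor_eq_zero) — direct. If h is even: ShiftedPrimesBombieriData (fed with
ElliottHalberstamInput) makes A = shiftedPrimesCounting h a Bombieri sequence with H = 𝔖({0,h}) and
A(x) ∼ x; UniformElliottShiftedPrimes at h is verbatim Axiom (M) for A (A.a n = Λ(n+h) by rfl, same
product order and casts); InverseSieveTheorem gives Σ_{n≤x}Λ(n)Λ(n+h) ∼ 𝔖 x on ℝ; restrict to x = N
∈ ℕ (Ioc 0 N = Icc 1 N) and rewrite u ∼ v as u − v = o(N). The conclusion is literally the body of
TauberianTwins.PairsHL (stmt-Parity-0867), fixed shift; uniform shifts / tuples / GHL proper are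
routed through DicksonFibration and are NOT claimed here.

Rationale: WHY THIS LINE. Bombieri's asymptotic sieve (BombieriAsymptoticSieve1976; FriedlanderIwaniecPisa1978
Thm 1; proved in tree as Literature.NumberTheory.Sieve.Bombieri1976_asymptotic_sieve_holds)
determines Σ a_n Λ_k for k ≥ 2 from level-1 Type-I data and leaves k = 1 free up to δ ∈ [0,2]
(Literature.NumberTheory.Sieve.bombieri_asymptotic_sieve_indeterminacy, proved); every ghost in
seventy-five years of parity literature (Selberg 1±λ, Bombieri 1+cλ, Ford2004 and
FordMaynard2024PrimeSieves §6 "modified Liouville functions", the Siegel model 1+χ of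
TaoTeravainen2021) is a pretentious-multiplicative twist, and Ford2004 §1 explicitly leaves open
whether Type-I data plus absence of "global parity bias" forces the asymptotics. The route imports
the structure-vs-randomness paradigm of additive combinatorics (inverse theorems, GreenTao2010) and
pretentious multiplicative number theory (Granville–Soundararajan distance, the uniform
non-pretentiousness of MatomakiRadziwillTao2015 Conj. 1.5/(1.8) and TaoFMP2016 Thm 1.3) into sieve
axiomatics: IST is a new SIEVE AXIOM (M) under which k = 1 closes, and for a_n = Λ(n+h) Axiom (M) is
the uniform Elliott conjecture on shifted primes (ESP; ancestry Kátai–Elliott–Hildebrand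
doi:10.1112/plms/s3-59.2.209, MurtyVatwani2017). What it does that route MobiusShiftedPrimes (EH ∧
dilated Möbius randomness M_avg ⟹ twins) does not: it removes the dilations m ≤ x^ε from the
arithmetic input — all multiplicative information is demanded at the top scale only — at the price
of a prime-free structural conjecture about ALL level-1 sieve sequences, which is independently
attackable (support item MultiplicativeGhosts is its provable first case, resting on Delange's
theorem and L(1,χ) ≠ 0) and independently refutable (construct one non-multiplicative ghost).
Checked while drafting: μ-orthogonality ALONE is not enough (a_n = 1 + λ(n)(1/4 − (3/4)·1_{2∣n}) has
the Type-I data of ℤ at level 1, Σ a_n μ(n) = o(x), yet δ = 3/4; it is caught by f = λ·1_{2∤n}),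
which is why Axiom (M) quantifies over all uniformly non-pretentious f; the fixed-sequence setting
makes the Siegel ghost harmless (f = χ_j has conductor > (log x)^D by Siegel and Jacobi-sum-small
shifted-prime correlation), so no exceptional-character clause is needed for fixed h. Negatives
index: empty at filing.

RANKED CRUXES. #2 InverseSieveTheorem (crux) — IST, contrapositive form (card Crux 1): for a fixed
sifted sequence A with Bombieri's hypotheses (A₁)–(A₅) (Literature IsBombieriSequence: size =
counting function, level x^{1−ε} ∀ε with max over y ≤ x, pointwise Brun–Titchmarsh, (A₄), density
series ζ(s+1)G(s)), density constant H, A(x) ∼ x, and Axiom (M) (uniform top-scale orthogonality,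
error ≤ εx, to all 1-bounded multiplicative f that are A₀-non-pretentious at scale x in the MRT
sense q ≤ A₀, |t| ≤ x), one has Σ_{n≤x} Λ(n) a_n ∼ H x. Equivalently: δ ≠ 1 ⟹ a correlates at
positive density with a uniformly non-pretentious multiplicative function. [difficulty:
open-problem] (why it might fail: Axiom (M) has error εx and cannot see the z-rough cell (density
1/log z) where R₁ = Σ_{q≤x^ε} log q Σ_{r rough} μ(r)a_{qr} lives; a Type-I-invisible ghost with
signs c_q varying non-multiplicatively in the smooth part q (block-diagonal Ford–Maynard
vector-Liouville at level 1−o(1)) would refute it.) [BombieriAsymptoticSieve1976,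
FriedlanderIwaniecPisa1978, Ford2004, FordMaynard2024PrimeSieves, MatomakiRadziwillTao2015,
Selberg1952Limitations, Ramare2010]
#3 UniformElliottShiftedPrimes (crux) — ESP, the uniform Elliott conjecture on shifted primes (card
Crux 2; = Axiom (M) for a_n = Λ(n+h)): for every h ≥ 1 and ε > 0 there is A₀ such that for all large
x and every 1-bounded multiplicative f with 𝔻(f, χn^{it}; x)² ≥ A₀ for all q ≤ A₀, χ mod q, |t| ≤ x:
|Σ_{n≤x} Λ(n+h) f(n)| ≤ ε x. Contains Σ_{p≤x} μ(p+h) = o(π(x)) (f = μ) and the Kátai–Elliott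
mean-value conjecture for f(p−1); the uniformity in f is the Matomäki–Radziwiłł–Tao
corrected-Elliott shape; ε(A₀) cannot decay faster than ≍ e^{−A₀} (f = Liouville of the y-smooth
part with log log y = A₀/2 has 𝔻² ≈ A₀ and correlation ≈ ∏_{p≤y}(1−2/(p−1))·x ≍ e^{−A₀}x).
[difficulty: open-problem] (why it might fail: Contains μ(p+h)-equidistribution, open even under GRH
(Pintz2015: even λ(p+2)=−1 i.o. is open); theorems only average over h (Lichtman2020) or log-average
integer pairs (TaoFMP2016); an adversarial f may exploit small prime factors of p+h; twists n^{it},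
|t|>x, are admitted.) [MatomakiRadziwillTao2015, TaoFMP2016, MurtyVatwani2017,
doi:10.1112/plms/s3-59.2.209, Lichtman2020, Pintz2015, KlurmanMangerelTeravainen2023, Elliott1994]
#9 ElliottHalberstamInput (support) — the Elliott–Halberstam conjecture (primes have level x^θ for
every θ < 1), the named conditional input of the line; same body as MobiusShiftedPrimes.MobiusEH
(stmt-Parity-0614) — filed for bookkeeping, grounders stamp, provers/refuters spend nothing.
[difficulty: open-problem] [Literature.NumberTheory.Sieve.LevelOfDistribution.ElliottHalberstam,
MurtyVatwani2017]
#9 LevelOneResidual (support) — Bombieri's level-1 bookkeeping at k = 1 (card Crux 3; Bombieri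
(1.13)–(1.14), FI Pisa 1978 §4 with k = 1): under (A₁)–(A₅), density constant H and A(x) ∼ x, for
every fixed ε ∈ (0,1): Σ_{n≤x} Λ(n)a_n = H x + R₁(x, x^ε) + o(x) with the residual R₁(x,z) = Σ_{m≤z}
log m Σ_{d≤x/m} μ(d) a_{dm} (split Λ = μ∗log at m ≤ z; the m > z part is Type-I at level x^{1−ε}:
main terms x(log x−1)Σ_{d≤x/z}μ(d)g(d) = o(x) and −xΣμ(d)g(d)log d → Hx by the PNT for g from (A₅);
boundary at m = z is o(x)). Provable now with the tree's FI1978 lemmata; it identifies δ−1 with the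
correlation of a against μ restricted to {q·rough}, the mechanism behind IST. [difficulty:
provable-now] [BombieriAsymptoticSieve1976, FriedlanderIwaniecPisa1978, BombieriRIMS1977,
FriedlanderIwaniecOpera2010]
#9 MultiplicativeGhosts (support) — IST for multiplicative perturbations (the triage's "pretentious
lemma", first provable case): if b is REAL multiplicative, |b| ≤ 1 (so a = 1 + b ≥ 0 has the density
1/d of ℤ), Type-I invisible at level 1 in the (A₂) form (Σ_{d≤x^θ} sup_{y≤x} |Σ_{m≤y/d} b(dm)| ≪_B
x(log x)^{−B} for all θ < 1, B) and orthogonal at the top scale to all uniformly non-pretentious f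
(Axiom (M) for b), then its prime mass vanishes: Σ_{n≤x} Λ(n) b(n) = o(x). Expected proof: if b is
itself non-pretentious take f = b (mean square of b forces |b(p)| < 1 on a divergent set, then
Delange/Halász); if b pretends to be χ (real): χ principal ⟹ Delange's theorem + d = 1 invisibility
force a vanishing local Euler factor at some p, contradicted by invisibility on pℕ, p²ℕ (T₁ = −2 vs
T₁ = 0); χ non-principal ⟹ the hyperbola expansion Σ_k h(k) S_χ(x/k) has top-window main term (u/2
log u)·L(1,χ)·(prime bias) ≠ 0 since L(1,χ) ≠ 0. [difficulty: L] [MatomakiRadziwillTao2015,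
GranvilleSoundararajan2008, Selberg1952Limitations, Ford2004]
#9 ShiftedPrimesBombieriData (support) — glue data (generalises the tree's h = 2 theorems
isBombieriSequence_shiftedPrimesCounting_two, bombieriA5_shiftedPrimesCounting_two,
shiftedPrimesCounting_size_isEquivalent to every even h): under EH, for even h ≠ 0 the counting
sequence a_n = Λ(n+h) (Literature shiftedPrimesCounting h) satisfies (A₁)–(A₅), has density constant
H = 𝔖({0,h}) (factorwise: p∣h gives p/(p−1), p∤h gives p(p−2)/(p−1)²) and A(x) ∼ x. Provable now:
(A₂),(A₃),(A₄) are in tree for all h; (A₁): d > 1 coprime to even h is odd so 1/φ(d) ≤ 1/2; (A₅):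
Σ_d g(d)d^{−s} = ζ(s+1)·∏_{p∣h}(1−p^{−1−s})∏_{p∤h}(1 + p^{−s}/(p(p−1))). [difficulty: provable-now]
[FriedlanderIwaniecPisa1978, BombieriRIMS1977,
Literature.NumberTheory.Sieve.SieveSequence.isBombieriSequence_shiftedPrimesCounting_two]

TWO-LAYER PLAN. Foreseen glued splits (k ≤ 3, depth 1), filed only when a crux closes or stalls with
a census: InverseSieveTheorem ⇐ LevelOneResidual → RoughCellPropagation (Type-I invisibility at
level 1 forces the sign pattern c_q on the cells {q·rough} to be the restriction of a multiplicative
function, i.e. top-scale Axiom (M) propagates to all dilations q ≤ x^ε with error relative to the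
rough mass) → InverseSieveTheorem; UniformElliottShiftedPrimes ⇐ (pointwise Kátai–Elliott for each
fixed non-pretentious f, h) → (uniformity upgrade via the MRT pretentious large sieve / Halász over
shifted primes) → UniformElliottShiftedPrimes; a tuple version (vector Bombieri sieve, Λ on one
coordinate) only after pairs close.

KILL CRITERIA. A Theorems file proving ¬InverseSieveTheorem (one fixed non-negative Bombieri
sequence with A(x) ∼ x, Axiom (M) and δ ≠ 1) closes the route `refuted:InverseSieveTheorem` — and is
itself worth publishing as the first non-multiplicative parity ghost; hand the witness to the
barrier catalogue next to FordFixedLevelBarrier. ¬UniformElliottShiftedPrimes for some h (an f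
uniformly non-pretentious yet correlating with Λ(n+h) at density) forces a PIVOT, not a close:
restate ESP for the sub-class of f that IST actually produces (real-valued, or λ·(pretentious to
1)), provided the IST proof attempt has by then identified that class; if the witness is λ-like it
refutes HL pairs under EH and closes every GHL route. ElliottHalberstamInput refuted at some θ < 1 ⟹
pivot to level 1−ε(x) variants or close. PairsHL proved elsewhere (any route) moots the Assembly but
not IST, which keeps stand-alone value as a Literature-level structure theorem.

NOT DECOMPOSED YET. The quantitative IST (how A₀, ε and the Type-I savings B trade; whether
(A₃)/(A₅) can be dropped); IST for sequences with A(x) ≁ x (polynomial densities, where k = 1 main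
terms need one more log than (A₄) gives); the k-tuple / vector form and anything uniform in h ≤ LN
(Siegel territory: GHL proper goes through DicksonFibration with a Landau–Siegel conjunct); the
log-averaged and almost-all-scales weakenings of ESP (entropy decrement) as stepping stones; the
exact class of f that an IST proof outputs (which would let ESP shrink).

CHEAPEST FALSIFIER. Construct the candidate ghost (α) of the card as a FIXED sequence and test Axiom
(M): a_n = 1 + λ(n)·g_j(Ω_{>y_j}(n)) on blocks n ∈ (X_j, X_{j+1}] with y_j = X_{j+1}^{ε_j}, ε_j → 0,
g_j non-constant of mean pattern making all Type-I sums ≪ x(log x)^{−B}; IST predicts either Type-I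
visibility (Buchstab/alternating-Buchstab oscillation of Σ_{rough} μ, i.e.
EquidistributionLimitBarrier used positively) or a positive-density correlation with f =
λ·χ₀^{(P(w))}. A kit job over x ≤ 10^7 measuring max_d |Σ_{m≤x/d} b(dm)|·(log x)^B for g(k) =
(−1)^k, r^k, 1_{k even} would already show the 1/(ε log x) (not log-power) savings computed by hand
this session for g(k) = r^k. Second cheapest: literature lookup whether Ford2004 Thm 2 sequences
(R(ν), no global parity bias, (S₁) true) extend to level 1 with (S₁) false.

NUMBERS. δ ranges over [0,2] at level 1 (bombieri_asymptotic_sieve_indeterminacy, witnesses 1 +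
(1−δ)λ). Known detections: 1±λ by f = λ (correlation x); λ·(−1)^n by λ·1_{2∤n} (x/2); 1 + λ(1/4 −
(3/4)1_{2∣n}) has Σa_nμ(n) = o(x) but δ = 3/4 (μ alone is insufficient; λ·1_{2∤n} gives x/8); Siegel
blocks 1+χ_j by f = χ_j ((φ(q)/q)x, conductor q_j > (log x)^D by Siegel). Sharpness of ESP's ε(A₀):
f = Liouville of the y-smooth part, y = exp(exp(A₀/2)), has 𝔻² ≈ A₀ and Σ_{p≤x} f(p−h) log p ≈
∏_{p≤y}(1−2/(p−1))·x ≍ e^{−A₀}x. Level needed: x^{1−ε} for every ε (FordFixedLevelBarrier: any fixed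
ν < 1 fails even for k ≥ 2). Items at open: 7 (2 cruxes, 4 support, 1 assembly).

DEFINITION REQUESTS. None. SieveSequence, IsBombieriSequence, HasDensityConstant,
shiftedPrimesCounting, pretentiousDistSq, twistedChar, singularSeries all exist in
Literature.NumberTheory.Sieve; Axiom (M) is spelled inline (a named `HasMultiplicativeOrthogonality
A` predicate in Literature/NumberTheory/Sieve would shorten three items — file only if a second
route wants it).

Novelty: Searches (2026-08-15): `lit search --source zbmath "Bombieri asymptotic sieve"` (20: Bombieri
1976/77, FI Pisa 1978, Ford2004, Ramare2010, FI 2022 'Exceptional zeros, sieve parity, Goldbach');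
`lit search --source zbmath "parity problem sieve multiplicative functions"` (4, unrelated: GGPY
almost-primes, Helfgott root numbers); `lit search --source zbmath "multiplicative functions shifted
primes"` (25: Hildebrand 1989 doi:10.1112/plms/s3-59.2.209, Barban–Levin 1968, Elliott 1995/2000,
Kátai); `lit read doi:10.1016/j.jnt.2009.10.014` pp.1–3 (Ramaré: refined error for P₂-restricted
asymptotic sieve, bilinear part as remainder — no inverse statement); `lit frontier Parity --since
2020` (30 rows, none on inverse sieve theorems); `lit bridges Parity --cross any` (30, monographs);
`lit galaxy search "parity problem in sieve theory" --star all` (3 hits: Neale, Lichtman–Teräväinen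
arXiv:2111.08912; crabby leg saturated); a second galaxy query, the local searchd hybrid leg,
OpenAlex and arXiv were rate-limited/saturated today (recorded in NOTES); barrier files
FordFixedLevel / ElliottOriginalForm / SelbergParity / PrimePairParity read at their BARRIER blocks;
the card's own triage (refuter-3) searches inherited (Tao 2007 blog 'Open question: the parity
problem in sieve theory' to be checked by the audit for the informal 'λ is essentially the only
obstruction' wording).
Nearest prior art found: Ford2004 §1 = arXiv:math/0401215 pp.3–4 (fixed-level ghosts; the printed
inquiry "whether or  [refs: 10.1112/plms/s3-59.2.209, 10.1016/j.jnt.2009.10.014`, 2111.08912, math/0401215, doi:10.1112/plms/s3-59.2.209, doi:10.1016/j.jnt.2009.10.014, Ford2004, Ramare2010, MurtyVatwani2017, MatomakiRadziwillTao2015]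

Barriers (technique_class: inverse-sieve asymptotic-sieve pretentious shifted-primes): - technique_class: inverse-sieve asymptotic-sieve pretentious shifted-primes
- Literature.Barriers.Parity.SelbergParityBarrier: not contested — IST classifies the indeterminacy
the barrier establishes; Selberg's 1±λ are the model ghosts and satisfy IST's conclusion (f = λ).
- Literature.Barriers.Parity.FordFixedLevelBarrier: evaded by hypothesis — IST demands level x^{1−ε}
for EVERY ε ((A₂) of IsBombieriSequence), exactly where Bombieri leaves one degree of freedom;
Ford's fixed-level ghosts and Ford–Maynard's Type-II-window ghosts are x-dependent families at level
ν < 1 and all carry global multiplicative bias, consistent with IST; the bet is that no level-1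
fixed-sequence ghost escapes multiplicativity.
- Literature.Barriers.Parity.MatomakiRadziwillTao2015_counterexample: respected by construction —
both Axiom (M) and ESP use the corrected, locally-uniform-in-t non-pretentiousness (all |t| ≤ x, all
q ≤ A₀), never the pointwise (1.6) form the counterexample kills.
- Literature.Barriers.Parity.PrimePairParity: the Assembly is not a weight-insertion-invariant sieve
deduction — ESP is false for the ghost-weighted primes (insert 1+λ(n): f = λ correlates), so §8 of
Polymath8b is met by supplying the non-sieve axiom explicitly (ESP), as the barrier demands.
- Literature.Barriers.Parity.SiegelZeroPrimePairBarrier: evaded by scope — fixed h only; in the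
Siegel world the block ghost 1+χ_j yields f = χ_j of conductor > (log x)^D (Siegel), admitted by
Axiom (M), and Σ_p χ_j(p+h) log p

History (route lifecycle, newest last):
- 2026-08-15T13:49:45Z · CLOSED retired — not-a-thesis: assembly does not conclude the sub-problem Statement (operator:999:1257524)

sub-problem: GeneralizedHardyLittlewood · status: closed(retired) · opened planner-plancard-Parity-GeneralizedHardyLittl-fe6c7a49-0 2026-08-15T11:46:09Z · rev 0 · ledger route-Parity-InverseSieve
GENERATED by the gate from the ledger (D-0016/17). Provers cite these decls: `theorem foo : Summit.Parity.GeneralizedHardyLittlewood.Theses.InverseSieve.<Decl> := …` in Summits/Parity/GeneralizedHardyLittlewood/Theorems/<Name>.lean.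
-/

namespace Summit.Parity.GeneralizedHardyLittlewood.Theses.InverseSieve

open scoped BigOperators Topology Manifold Classical MeasureTheory ProbabilityTheory Matrix InnerProductSpace ComplexConjugate ContinuousMap
open Filter Set Function TopologicalSpace MeasureTheory

attribute [summit_statement] _root_.GeneralizedHardyLittlewood

/-- item stmt-Parity-6350 · crux · rank 2 · closed · moot by None · by planner
why it might fail: Axiom (M) has error εx and cannot see the z-rough cell (density 1/log z) where R₁ = Σ_{q≤x^ε} log q Σ_{r rough} μ(r)a_{qr} lives; a Type-I-invisible ghost with signs c_q varying non-multiplicatively in the smooth part q (block-diagonal Ford–Maynard vector-Liouville at level 1−o(1)) would refute it.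
sources: BombieriAsymptoticSieve1976, FriedlanderIwaniecPisa1978, Ford2004, FordMaynard2024PrimeSieves, MatomakiRadziwillTao2015, Selberg1952Limitations
[crux] IST, contrapositive form (card Crux 1): for a fixed sifted sequence A with Bombieri's
hypotheses (A₁)–(A₅) (Literature IsBombieriSequence: size = counting function, level x^{1−ε} ∀ε with
max over y ≤ x, pointwise Brun–Titchmarsh, (A₄), density series ζ(s+1)G(s)), density constant H,
A(x) ∼ x, and Axiom (M) (uniform top-scale orthogonality, error ≤ εx, to all 1-bounded
multiplicative f that are A₀-non-pretentious at scale x in the MRT sense q ≤ A₀, |t| ≤ x), one has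
Σ_{n≤x} Λ(n) a_n ∼ H x. Equivalently: δ ≠ 1 ⟹ a correlates at positive density with a uniformly
non-pretentious multiplicative function. [difficulty: open-problem] -/
@[route_item "route-Parity-InverseSieve"]
def InverseSieveTheorem : Prop :=
  ∀ (A : Literature.NumberTheory.Sieve.SieveSequence) (H : ℝ), A.IsBombieriSequence → A.HasDensityConstant H → Asymptotics.IsEquivalent Filter.atTop A.size (fun x : ℝ => x) → (∀ ε : ℝ, 0 < ε → ∃ A₀ : ℝ, ∀ᶠ x : ℝ in Filter.atTop, ∀ f : ArithmeticFunction ℂ, f.IsMultiplicative → (∀ n, ‖f n‖ ≤ 1) → (∀ (q : ℕ) (χ : DirichletCharacter ℂ q) (t : ℝ), 1 ≤ q → (q : ℝ) ≤ A₀ → |t| ≤ x → A₀ ≤ Literature.NumberTheory.Sieve.pretentiousDistSq (⇑f) (Literature.NumberTheory.Sieve.twistedChar χ t) x) → ‖∑ n ∈ Finset.Ioc 0 ⌊x⌋₊, ((A.a n : ℝ) : ℂ) * f n‖ ≤ ε * x) → Asymptotics.IsEquivalent Filter.atTop (fun x : ℝ => ∑ n ∈ Finset.Ioc 0 ⌊x⌋₊,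 ArithmeticFunction.vonMangoldt n * A.a n) (fun x : ℝ => H * x)

/-- item stmt-Parity-6351 · crux · rank 3 · closed · moot by None · by planner
why it might fail: Contains μ(p+h)-equidistribution, open even under GRH (Pintz2015: even λ(p+2)=−1 i.o. is open); theorems only average over h (Lichtman2020) or log-average integer pairs (TaoFMP2016); an adversarial f may exploit small prime factors of p+h; twists n^{it}, |t|>x, are admitted.
sources: MatomakiRadziwillTao2015, TaoFMP2016, MurtyVatwani2017, doi:10.1112/plms/s3-59.2.209, Lichtman2020, Pintz2015
[crux] ESP, the uniform Elliott conjecture on shifted primes (card Crux 2; = Axiom (M) for a_n =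
Λ(n+h)): for every h ≥ 1 and ε > 0 there is A₀ such that for all large x and every 1-bounded
multiplicative f with 𝔻(f, χn^{it}; x)² ≥ A₀ for all q ≤ A₀, χ mod q, |t| ≤ x: |Σ_{n≤x} Λ(n+h) f(n)|
≤ ε x. Contains Σ_{p≤x} μ(p+h) = o(π(x)) (f = μ) and the Kátai–Elliott mean-value conjecture for
f(p−1); the uniformity in f is the Matomäki–Radziwiłł–Tao corrected-Elliott shape; ε(A₀) cannot
decay faster than ≍ e^{−A₀} (f = Liouville of the y-smooth part with log log y = A₀/2 has 𝔻² ≈ A₀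
and correlation ≈ ∏_{p≤y}(1−2/(p−1))·x ≍ e^{−A₀}x). [difficulty: open-problem] -/
@[route_item "route-Parity-InverseSieve"]
def UniformElliottShiftedPrimes : Prop :=
  ∀ h : ℕ, 1 ≤ h → ∀ ε : ℝ, 0 < ε → ∃ A₀ : ℝ, ∀ᶠ x : ℝ in Filter.atTop, ∀ f : ArithmeticFunction ℂ, f.IsMultiplicative → (∀ n, ‖f n‖ ≤ 1) → (∀ (q : ℕ) (χ : DirichletCharacter ℂ q) (t : ℝ), 1 ≤ q → (q : ℝ) ≤ A₀ → |t| ≤ x → A₀ ≤ Literature.NumberTheory.Sieve.pretentiousDistSq (⇑f) (Literature.NumberTheory.Sieve.twistedChar χ t) x) → ‖∑ n ∈ Finset.Ioc 0 ⌊x⌋₊, ((ArithmeticFunction.vonMangoldt (n + h) : ℝ) : ℂ) * f n‖ ≤ ε * x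

/-- item stmt-Parity-0614 · support · rank 9 · closed · moot by None · by planner
sources: Literature.NumberTheory.Sieve.LevelOfDistribution.ElliottHalberstam, MurtyVatwani2017
Elliott–Halberstam conjecture in level-of-distribution form: PrimesHaveLevel θ for every θ < 1
(existing Literature Prop Literature.NumberTheory.Sieve.LevelOfDistribution.ElliottHalberstam;
equivalent to Literature.NumberTheory.Sieve.ElliottHalberstamConjecture by
Literature.NumberTheory.Sieve.elliottHalberstam_iff_wave0). Named open conjecture, filed for
bookkeeping: grounders stamp, refuters/provers should not spend effort. -/
@[route_item "route-Parity-InverseSieve"]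
def ElliottHalberstamInput : Prop :=
  Literature.NumberTheory.Sieve.LevelOfDistribution.ElliottHalberstam

/-- item stmt-Parity-6352 · support · rank 9 · closed · moot by None · by planner
sources: BombieriAsymptoticSieve1976, FriedlanderIwaniecPisa1978, BombieriRIMS1977, FriedlanderIwaniecOpera2010
[support] Bombieri's level-1 bookkeeping at k = 1 (card Crux 3; Bombieri (1.13)–(1.14), FI Pisa 1978
§4 with k = 1): under (A₁)–(A₅), density constant H and A(x) ∼ x, for every fixed ε ∈ (0,1): Σ_{n≤x}
Λ(n)a_n = H x + R₁(x, x^ε) + o(x) with the residual R₁(x,z) = Σ_{m≤z} log m Σ_{d≤x/m} μ(d) a_{dm}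
(split Λ = μ∗log at m ≤ z; the m > z part is Type-I at level x^{1−ε}: main terms x(log
x−1)Σ_{d≤x/z}μ(d)g(d) = o(x) and −xΣμ(d)g(d)log d → Hx by the PNT for g from (A₅); boundary at m = z
is o(x)). Provable now with the tree's FI1978 lemmata; it identifies δ−1 with the correlation of a
against μ restricted to {q·rough}, the mechanism behind IST. [difficulty: provable-now] -/
@[route_item "route-Parity-InverseSieve"]
def LevelOneResidual : Prop :=
  ∀ (A : Literature.NumberTheory.Sieve.SieveSequence) (H : ℝ), A.IsBombieriSequence → A.HasDensityConstant H → Asymptotics.IsEquivalent Filter.atTop A.size (fun x : ℝ => x) → ∀ ε : ℝ, 0 < ε → ε < 1 → (fun x : ℝ => (∑ n ∈ Finset.Ioc 0 ⌊x⌋₊, ArithmeticFunction.vonMangoldt n * A.a n) - H * x - ∑ m ∈ Finset.Icc 1 ⌊x ^ ε⌋₊, Real.log m * ∑ d ∈ Finset.Icc 1 ⌊x / m⌋₊, (ArithmeticFunction.moebius d : ℝ) * A.a (d * m)) =o[Filter.atTop] fun x : ℝ => x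

/-- item stmt-Parity-6353 · support · rank 9 · closed · moot by None · by planner
sources: MatomakiRadziwillTao2015, GranvilleSoundararajan2008, Selberg1952Limitations, Ford2004
[support] IST for multiplicative perturbations (the triage's "pretentious lemma", first provable
case): if b is REAL multiplicative, |b| ≤ 1 (so a = 1 + b ≥ 0 has the density 1/d of ℤ), Type-I
invisible at level 1 in the (A₂) form (Σ_{d≤x^θ} sup_{y≤x} |Σ_{m≤y/d} b(dm)| ≪_B x(log x)^{−B} for
all θ < 1, B) and orthogonal at the top scale to all uniformly non-pretentious f (Axiom (M) for b),
then its prime mass vanishes: Σ_{n≤x} Λ(n) b(n) = o(x). Expected proof: if b is itself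
non-pretentious take f = b (mean square of b forces |b(p)| < 1 on a divergent set, then
Delange/Halász); if b pretends to be χ (real): χ principal ⟹ Delange's theorem + d = 1 invisibility
force a vanishing local Euler factor at some p, contradicted by invisibility on pℕ, p²ℕ (T₁ = −2 vs
T₁ = 0); χ non-principal ⟹ the hyperbola expansion Σ_k h(k) S_χ(x/k) has top-window main term (u/2
log u)·L(1,χ)·(prime bias) ≠ 0 since L(1,χ) ≠ 0. [difficulty: L] -/
@[route_item "route-Parity-InverseSieve"]
def MultiplicativeGhosts : Prop :=
  ∀ b : ArithmeticFunction ℝ, b.IsMultiplicative → (∀ n, |b n| ≤ 1) → (∀ θ : ℝ, θ < 1 → ∀ B : ℝ, 0 < B → ∃ C : ℝ, ∀ᶠ x : ℝ in Filter.atTop, ∀ y : ℕ → ℝ, (∀ d, y d ≤ x) → ∑ d ∈ Finset.Icc 1 ⌊x ^ θ⌋₊, |∑ m ∈ Finset.Icc 1 ⌊y d / d⌋₊, b (d * m)| ≤ C * x / Real.log x ^ B) → (∀ ε : ℝ, 0 < ε → ∃ A₀ : ℝ, ∀ᶠ x : ℝ in Filter.atTop, ∀ f : ArithmeticFunction ℂ,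 f.IsMultiplicative → (∀ n, ‖f n‖ ≤ 1) → (∀ (q : ℕ) (χ : DirichletCharacter ℂ q) (t : ℝ), 1 ≤ q → (q : ℝ) ≤ A₀ → |t| ≤ x → A₀ ≤ Literature.NumberTheory.Sieve.pretentiousDistSq (⇑f) (Literature.NumberTheory.Sieve.twistedChar χ t) x) → ‖∑ n ∈ Finset.Ioc 0 ⌊x⌋₊, ((b n : ℝ) : ℂ) * f n‖ ≤ ε * x) → (fun x : ℝ => ∑ n ∈ Finset.Ioc 0 ⌊x⌋₊, ArithmeticFunction.vonMangoldt n * b n) =o[Filter.atTop] fun x : ℝ => x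

/-- item stmt-Parity-6354 · support · rank 9 · closed · moot by None · by planner
sources: FriedlanderIwaniecPisa1978, BombieriRIMS1977, Literature.NumberTheory.Sieve.SieveSequence.isBombieriSequence_shiftedPrimesCounting_two
[support] glue data (generalises the tree's h = 2 theorems
isBombieriSequence_shiftedPrimesCounting_two, bombieriA5_shiftedPrimesCounting_two,
shiftedPrimesCounting_size_isEquivalent to every even h): under EH, for even h ≠ 0 the counting
sequence a_n = Λ(n+h) (Literature shiftedPrimesCounting h) satisfies (A₁)–(A₅), has density constant
H = 𝔖({0,h}) (factorwise: p∣h gives p/(p−1), p∤h gives p(p−2)/(p−1)²) and A(x) ∼ x. Provable now: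
(A₂),(A₃),(A₄) are in tree for all h; (A₁): d > 1 coprime to even h is odd so 1/φ(d) ≤ 1/2; (A₅):
Σ_d g(d)d^{−s} = ζ(s+1)·∏_{p∣h}(1−p^{−1−s})∏_{p∤h}(1 + p^{−s}/(p(p−1))). [difficulty: provable-now] -/
@[route_item "route-Parity-InverseSieve"]
def ShiftedPrimesBombieriData : Prop :=
  Literature.NumberTheory.Sieve.LevelOfDistribution.ElliottHalberstam → ∀ h : ℕ, h ≠ 0 → Even h → (Literature.NumberTheory.Sieve.SieveSequence.shiftedPrimesCounting h).IsBombieriSequence ∧ (Literature.NumberTheory.Sieve.SieveSequence.shiftedPrimesCounting h).HasDensityConstant (Literature.NumberTheory.Sieve.singularSeries ({0, (h : ℤ)} : Finset ℤ)) ∧ Asymptotics.IsEquivalent Filter.atTop (Literature.NumberTheory.Sieve.SieveSequence.shiftedPrimesCounting h).size (fun x : ℝ => x)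

/-- item stmt-Parity-6355 · assembly · rank 1 · closed · moot by None · by planner
sources: BombieriAsymptoticSieve1976, HardyLittlewood1923, MurtyVatwani2017
[assembly] ElliottHalberstamInput → ShiftedPrimesBombieriData → InverseSieveTheorem →
UniformElliottShiftedPrimes → Hardy–Littlewood pairs for every fixed h ≥ 1 (Λ-form, o(N) error). -/
@[route_item "route-Parity-InverseSieve"]
def Assembly : Prop :=
  ElliottHalberstamInput → ShiftedPrimesBombieriData → InverseSieveTheorem → UniformElliottShiftedPrimes → ∀ h : ℕ, 1 ≤ h → (fun N : ℕ => ∑ n ∈ Finset.Icc 1 N, ArithmeticFunction.vonMangoldt n * ArithmeticFunction.vonMangoldt (n + h) - Literature.NumberTheory.Sieve.singularSeries ({0, (h : ℤ)} : Finset ℤ) * N) =o[Filter.atTop] fun N : ℕ => (N : ℝ)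

end Summit.Parity.GeneralizedHardyLittlewood.Theses.InverseSieve
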